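import Summits.MatrixMultiplication.OmegaCensus.Cyclic17Dihedral34Record
import Literature.RepresentationTheory.FiniteGroups.DihedralCharacterDegrees
import Literature.Computability.AlgebraicComplexity.CohnUmansTPPProofs
import HarnessLib

/-!
# ω-census: the `C₁₇ × D₃₄` record `⟨18, 8, 8⟩` beats the sum of the cubes AT KERNEL GRADE — `Σ d³ = 1122 < 1152`, hence `ω < 3` by CKSU Thm. 1.8

Cell `pub-omega` (HOME `run/shared/lean/pub/pub-omega/`, unit `pub-omega-lit`, gen 15), topic
`Summits/MatrixMultiplication/OmegaCensus`; companion of `Cyclic17Dihedral34Record.lean` (speedrun lane `tpp` /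
seat `stpp-3`, census row Pb44).  Framing (verbatim): lottery ticket; floor = certified bounds/negative ranges.
HONEST FRAMING: nothing here improves a bound on `ω` (the tree has `ω < 2.38`); the point is that the census row's
character-degree bookkeeping, which `Cyclic17Dihedral34Record.lean` had to leave in its docstring ("the tree has no
character table of `D_{2n}`"; "CONSEQUENCE (informal here, by `CKSU2005_thm18.omega_lt_three` once
`charDegreePowSum G 3 = 1122` is supplied)"), is now a theorem, so the row is kernel-checked END TO END:

* `charDegreePowSum_G` — `Σ_{χ ∈ Irr(C₁₇ × D₃₄)} χ(1)^s = 17 · (2 + 8 · 2^s)` for every real `s`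
  (James–Liebeck §18.3 Case 1 for `D₃₄ = DihedralGroup 17`: two linear characters and `8` of degree `2`;
  Thm. 19.18 for the product with `C₁₇`; tree `charDegreePowSum_comm_prod_dihedralGroup_odd` of
  `Literature/RepresentationTheory/FiniteGroups/DihedralCharacterDegrees.lean`);
* `charDegreePowSum_G_three` — **`Σ d³ = 1122`** (the docstring value of the record file);
* `charDegreePowSum_G_three_lt_volume` — `1122 < 1152 = 18 · 8 · 8`;
* `CKSU2005_thm18_record` — the Cohn–Umans 2003 Thm. 4.1 / CKSU 2005 Thm. 1.8 inequality for this triple with the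
  character-degree side evaluated: `1152^{ω/3} ≤ 17 · (2 + 8 · 2^ω)` (tree `CKSU2005_thm18_holds`, DISCHARGED, applied to
  `realizesTPP_18_8_8`);
* `omega_lt_three_of_record` — **`ω < 3` from this single TPP triple** (`CKSU2005_thm18_holds.omega_lt_three`).

Numerically the inequality `1152^{w/3} ≤ 17 (2 + 8 · 2^w)` holds exactly for `w ≤ w*` with `w* ≈ 2.98427` (cell
lead's arithmetic, census row Pb44; NOT certified here — only `ω < 3` is).  0 named facts; 0 `sorry`.

References: Cohn–Umans 2003, Thm. 4.1 [CohnUmans2003]; Cohn–Kleinberg–Szegedy–Umans 2005, Thm. 1.8, §2 ("beating the sum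
of the cubes") [CohnKleinbergSzegedyUmans2005]; James–Liebeck 2001, §18.3, Thm. 19.18 [JamesLiebeck2001].
-/

noncomputable section

namespace Summit.MatrixMultiplication.OmegaCensus.Cyclic17Dihedral34Record

open Literature.RepresentationTheory.FiniteGroups Literature.Computability.AlgebraicComplexity

/-- **`Σ_{χ ∈ Irr(C₁₇ × D₃₄)} χ(1)^s = 17 · (2 + 8 · 2^s)`**: `D₃₄` has two linear characters and `8 = (17-1)/2`
irreducible characters of degree `2` (James–Liebeck §18.3, `n = 17` odd), and the `17` linear characters of `C₁₇`
multiply through (James–Liebeck Thm. 19.18). [cite: JamesLiebeck2001, §18.3] [cite: JamesLiebeck2001, Thm. 19.18] -/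
theorem charDegreePowSum_G (s : ℝ) : charDegreePowSum G s = 17 * (2 + 8 * (2 : ℝ) ^ s) := by
  have h := charDegreePowSum_comm_prod_dihedralGroup_odd (C := Multiplicative (ZMod 17)) (n := 17)
    (by decide) s
  rw [Fintype.card_multiplicative, ZMod.card] at h
  rw [show charDegreePowSum G s = charDegreePowSum (Multiplicative (ZMod 17) × DihedralGroup 17) s from rfl, h]
  norm_num

/-- **`Σ d³ (C₁₇ × D₃₄) = 1122`** (`= 17 · (2 + 8 · 8) = 17 · 66`; the value kept in the docstring of
`Cyclic17Dihedral34Record.lean`). [cite: JamesLiebeck2001, §18.3] -/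
theorem charDegreePowSum_G_three : charDegreePowSum G 3 = 1122 := by
  rw [charDegreePowSum_G, show (3 : ℝ) = ((3 : ℕ) : ℝ) by norm_num, Real.rpow_natCast]
  norm_num

/-- The volume `18 · 8 · 8 = 1152` of the record triple exceeds `Σ d³ = 1122` ("beating the sum of the cubes",
CKSU 2005 §2), now with `Σ d³` the tree's `charDegreePowSum G 3`. [cite: CohnKleinbergSzegedyUmans2005, §2] -/
theorem charDegreePowSum_G_three_lt_volume : charDegreePowSum G 3 < ((18 * 8 * 8 : ℕ) : ℝ) := by
  rw [charDegreePowSum_G_three]; norm_num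

/-- **CKSU 2005 Thm. 1.8 for the record triple, character-degree side evaluated**:
`(18 · 8 · 8)^{ω/3} ≤ Σ_χ χ(1)^ω = 17 · (2 + 8 · 2^ω)` (tree `CKSU2005_thm18_holds` applied to `realizesTPP_18_8_8`).
[cite: CohnKleinbergSzegedyUmans2005, Thm. 1.8] -/
theorem CKSU2005_thm18_record :
    ((18 * 8 * 8 : ℕ) : ℝ) ^ (omega ℂ / 3) ≤ 17 * (2 + 8 * (2 : ℝ) ^ omega ℂ) := by
  rw [← charDegreePowSum_G]
  exact CKSU2005_thm18_holds G 18 8 8 realizesTPP_18_8_8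

/-- **`ω < 3` from the single TPP triple `⟨18, 8, 8⟩` of `C₁₇ × D₃₄`** (CKSU 2005 §2: Thm. 1.8 with
`Σ d³ = 1122 < 1152`; tree `CKSU2005_thm18.omega_lt_three`).  No improvement of any bound on `ω` — the census datum is
that a group of order `578` beats the sum of the cubes, kernel-checked on both sides.
[cite: CohnKleinbergSzegedyUmans2005, §2] -/
theorem omega_lt_three_of_record : omega ℂ < 3 :=
  CKSU2005_thm18_holds.omega_lt_three realizesTPP_18_8_8 charDegreePowSum_G_three_lt_volume

end Summit.MatrixMultiplication.OmegaCensus.Cyclic17Dihedral34Record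

end
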